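import Literature.NumberTheory.EllipticCurves.Kato2004.EulerSystemValues
import Literature.NumberTheory.EllipticCurves.IwasawaSelmer
import Literature.NumberTheory.EllipticCurves.ZpExtension
import HarnessLib

/-!
# Kato 2004 (Astérisque 295) §8.2 with Lemma 8.5, §12.2 and Thm. 12.4: the Iwasawa cohomology
# `𝐇¹(T) = lim← H¹(ℤ[ζ_{p^n}, 1/p], T)` of `T = T_pE` along the cyclotomic `ℤ_p`-tower, as a PINNED
# `Λ`-module interface (`IwasawaH1Data`), and Thm. 12.4 (2)(3) on it as a named fact

Topic `NumberTheory/EllipticCurves`, sub-directory `Kato2004` (namespace = path). Cell `bsd-smallim`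
(rung K6 of `BirchSwinnertonDyer`, class X9), seat `bsd-smallim-k6-ty` (typer): the Λ-adic
Galois-cohomology VOCABULARY in which the cell's `μ`-transfer argument (HOME/koly/KOLY-MEMO.md §5.7,
MU-TRANSFER-PROOF.md: "`𝐳₁ ∉ p𝐇¹ ⟹ μ(𝐇²) = 0`", crux `MuTransfer` = item 19629 of route
`SmallImageMuTransfer`, obligation node `Summit.…Rank1Residual.KatoMuTransfer`) and Kato's own §17.13
bookkeeping (tree: `KatoDivisibilitySkeletonProofs`, `KatoDivisibilityIntegralSkeletonProofs`,
`Kato2004/MainConjectureSkeletonProofs` — all with `H = 𝐇¹` an ABSTRACT hypothesis module) can be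
stated about ONE honest object. HONEST FRAMING: definitions with bodies, unfolding lemmas, and two
named facts (`def … : Prop`, D-0014; nothing asserted, no `_holds` here); BSD is not advanced by this
file; the consumer's closes are rung-level and conditional on named facts.

## The printed statements (K. Kato, Astérisque 295 (2004); `[p. N]` = printed page; store key
`paper:doi-10-24033-ast-639`, PDF page `N − 115`)

* **§8.2 [pp. 180–181]** "for a ring `R`, we denote the étale cohomology group `H^q_ét(Spec(R), )` simply
  by `H^q(R, )`. In the case `R` is an integral domain with field of fractions `K`, we denote
  `H^q(R, j_*(𝔄))` simply by `H^q(R, 𝔄)` … For a finitely generated `ℤ_p`-module `T` endowed with … a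
  continuous action of `Gal(K̄/K)` which is unramified at almost all finite places of `K`, we denote
  `H^q(R, T) = lim←_n H^q(R, T/p^n)`."  **Lemma 8.5** ([Pe0, 2.2.4], [Ru4, B3.3]) [pp. 183–184]:
  "(1) For any set `S` of finite places of `K` containing all places lying over `p`, the canonical map
  `H¹(O_K[S⁻¹], T) → H¹(K, T)` is injective", with, in the proof [p. 184], "`H¹(O_v, T) =
  H¹(Gal(K_v^{ur}/K_v), H⁰(K_v^{ur}, T))` … and hence `H¹(O_v, T) → H¹(K_v, T)` is injective" for every
  maximal ideal `v` of `O_K[1/p]`.  READING (the same as clause (C2) of `Kato2004.ZetaBody`, design D3 of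
  record of `EulerSystemValues.lean`): the image of `H¹(O_F[1/p], T) ↪ H¹(F, T)` is the set of classes
  whose restriction to EVERY inertia group `I_w ∩ Gal(ℚ̄/F)`, `w ∤ p`, vanishes (Leray for `j`,
  `(R¹j_*)_w = H¹(I_w, ·)`; places over the conductor INCLUDED) — `integralH1` below.
* **§12.1 [p. 219]** `G_∞ = Gal(ℚ(ζ_{p^∞})/ℚ) ≅ ℤ_p^×` (cyclotomic character `κ`); for `p ≠ 2`,
  `G_∞ ≅ Δ × G¹_∞`, `Δ ≅ ℤ/(p−1)`, `G¹_∞ ≅ ℤ_p`; **(12.1.2)** "`O_L[[G_∞]]` is a two dimensional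
  complete semi-local ring"; for `p ≠ 2`, `O_L[[G_∞]] ≅ ∏_{j ∈ ℤ/(p−1)} O_L[[G_∞]]_j`,
  `O_L[[G_∞]]_j ≅ O_L[[T]]`.
* **§12.2 [p. 220]** "Let `T` be a finitely generated `ℤ_p`-module endowed with a continuous action of
  `Gal(ℚ̄/ℚ)` which is unramified at almost all prime numbers. We denote for `q ∈ ℤ`
  `𝐇^q(T) = lim←_n H^q(ℤ[ζ_{p^n}, 1/p], T)` where `H^q` is the etale cohomology as in 8.2, and the
  inverse limit is taken with respect to trace maps. The following are known: **(12.2.1)** `𝐇^q(T) = 0`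
  if `q ≠ 1, 2` and `𝐇¹(T)` and `𝐇²(T)` are finitely generated `ℤ_p[[G_∞]]`-modules. **(12.2.2)** For any
  prime ideal `𝔮` of `ℤ_p[[G_∞]]` of height `0` …, `dim(𝐇¹(T)_𝔮) − dim(𝐇²(T)_𝔮) = rank_{ℤ_p}(T⁻)` …
  ([Ta2, Thm. 2.2], [Pe3, §1.3])."  Proof of 12.4 (2) [p. 228]: "For `n ≥ 0`,
  `H^q(ℤ[ζ_{p^n}, 1/p], T) ≅ H^q(ℤ[1/p], T ⊗_{O_λ} O_λ[G_n])` where `Gal(ℚ̄/ℚ)` acts on the tensor product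
  … by `σ ⊗ σ_n⁻¹` … Hence `𝐇^q(T) = lim←_n H^q(ℤ[1/p], T ⊗ O_λ[G_n])`" (Shapiro).
* **§12.3 / Theorem 12.4 [p. 221]** "`Λ = O_λ[[G_∞]]`. Consider the two dimensional representation
  `V_{F_λ}(f)` of `Gal(ℚ̄/ℚ)` over `F_λ` associated to `f` (8.3). … **Theorem 12.4.** — Take any
  `Gal(ℚ̄/ℚ)`-stable `O_λ`-lattice `T` of `V_{F_λ}`. Then: (1) `𝐇²(T)` is a torsion `Λ`-module.
  (2) `𝐇¹(T)` is a torsion free `Λ`-module, and `𝐇¹(T) ⊗ ℚ = 𝐇¹(V_{F_λ}(f))` is a free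
  `Λ ⊗ ℚ`-module of rank `1`. (3) If `p ≠ 2` and if `T/m_λT` is irreducible as a two dimensional
  representation of `Gal(ℚ̄/ℚ)` over `O_λ/m_λ`, `𝐇¹(T)` is a free `Λ`-module of rank `1`."
  (Proofs: §13.8 [pp. 227–229] for `f` without CM — (1) from (12.8.2), Thm. 13.4 (1), 13.7; (2) from
  (12.2.2) and the Shapiro identity; (3) "`x` and `y` form a regular sequence for `𝐇¹(T)`" using the
  irreducibility of `T/m_λT` — and §15 for CM forms, via Rubin [Ru1].)
* **§13.1, (13.1.1), Ex. 13.3, Thm. 13.4 [pp. 224–226]** — quoted in `EulerSystemValues.lean`; Thm. 13.4: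
  "let `(z_m)_m` be an Euler system for `(T, L, Σ)`. Let `Λ = O_L[[G_∞]]`, let `Z` be the
  `Λ`-submodule of `𝐇¹(T)` generated by `(z_{p^n})_n`": a norm-compatible family of integral classes
  IS an element of `𝐇¹(T)` — `IwasawaH1Data.exists_unique_lift` below is exactly this sentence.

## The elliptic-curve specialisation and the PIN (what the Lean structure transcribes)

`f = f_E`, `k = 2`, `F = ℚ`, `O_λ = ℤ_p`, and `T = T_pW` = the tree's continuous Tate module
`tateRep W p` (`EulerSystemValues.lean`; `V_{ℤ_p}(f)(1) ≅ T_pE` up to `ℤ_pˣ·p^ℤ` under `Irr(W[p])`,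
design D1 (a) of that file — here only `T_pW` itself occurs).  The tree's Iwasawa algebra is
`Λ = IwasawaAlgebra p = ℤ_p⟦T⟧` with `T = γ − 1` for a topological generator `γ` of the Galois group
`Γ ≅ ℤ_p` of a `ℤ_p`-extension `κ : ZpExtension ℚ p` (file `ZpExtension`; `κ.layerSubgroup n =
Gal(ℚ̄/ℚ_n)`, `κ.IsCyclotomic`, `κ.IsTopGenerator γ`), exactly as in `WeierstrassCurve.SelmerDualData`
(file `IwasawaSelmer`) and in `kato_divisibility` (file `PAdicBSD`).  Accordingly this file types the
module
  `𝐇¹_Γ(T) := lim←_n H¹(ℤ_n[1/p], T_pW)`  (`ℤ_n` = integers of the `n`-th layer `ℚ_n` of `κ`),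
along the layers of `κ`, with `T` acting as `conj_γ − 1`.  READING (two lines, `p` odd, `κ`
cyclotomic): `ℚ_n ⊂ ℚ(ζ_{p^{n+1}})` with `Gal(ℚ(ζ_{p^{n+1}})/ℚ_n) = Δ` of order `p − 1` prime to `p`,
so restriction identifies `H¹(ℤ_n[1/p], T)` with `H¹(ℤ[ζ_{p^{n+1}}, 1/p], T)^Δ` (`cor ∘ res = p − 1`)
and `𝐇¹_Γ(T) = 𝐇¹(T)^Δ = e₀·𝐇¹(T)`, the `Δ`-trivial component of Kato's `𝐇¹(T)`, a module over
`e₀·ℤ_p[[G_∞]] = ℤ_p[[G¹_∞]] = ℤ_p⟦T⟧` ((12.1.2)).  Hence every clause of Thm. 12.4 (2)(3) for `𝐇¹(T)`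
over `Λ_Kato = ∏_j ℤ_p⟦T⟧` yields the same clause for `𝐇¹_Γ(T)` over `ℤ_p⟦T⟧` (a direct factor of a
torsion-free / free rank-one module over a product ring is torsion-free / free of rank one over the
factor) — the named fact `thm12_4` states exactly these consequences, a SPECIAL CASE of print, never
stronger; `-- TODO(general form)` records the rest.
READING AT `p = 2` (the `def`s below quantify over every prime; D-audit `bsd-2adic-audit-2` GEN 10,
2026-08-27, sheet `run/shared/lean/pub/bsd-2adic/audit/D-AUDIT-h12at2-Kato04-Thm124-Gamma-tower-at-2.md`).
Here `Δ` = the torsion of `G_∞ ≅ ℤ₂ˣ` is `{1, c}` of order `2 = p` (`c` = complex conjugation),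
`ℚ_n = ℚ(ζ_{2^{n+2}})⁺`, and Kato's `Λ_K = ℤ₂[Δ]⟦T⟧` has NO idempotent `e₀`: by (12.1.1)–(12.1.2)
[p. 219] "If `p = 2`, the canonical map `O_L[[G_∞]] → ∏_{j ∈ ℤ/2} O_L[[G_∞]]_j` is injective and the
cokernel is killed by `2`", so the direct-factor sentence above does not apply as written.  The same
conclusion — clauses (12.2.1) and (2) for `𝐇¹_Γ(T₂W)` over `ℤ₂⟦T⟧` — holds instead as follows (print's
clause (3) keeps its guard `p ≠ 2` and is not at issue).  (β₂.1) With `K_n := ℚ(ζ_{2^{n+2}}) = ℚ_n(i)`,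
the restriction `H¹(ℚ_n, T₂W) → H¹(K_n, T₂W)` is injective (inflation–restriction: its kernel is
`H¹(Δ, (T₂W)^{Gal(ℚ̄/K_n)})` and `(T₂W)^{Gal(ℚ̄/K_n)} = lim← E(K_n)[2^m] = 0`, `E(K_n)[2^∞]` being
finite); it preserves the integral classes and commutes with the trace maps of the two towers
(`K_{n+1} = K_n·ℚ_{n+1}`, `K_n ∩ ℚ_{n+1} = ℚ_n`), so `𝐇¹_Γ(T₂W) ↪ 𝐇¹(T₂W)` equivariantly for
`ℤ₂[[Γ′]] = ℤ₂⟦T⟧ ⊂ Λ_K`, `Γ′ = Gal(ℚ(ζ_{2^∞})/ℚ(i)) ≅ Gal(ℚ_∞/ℚ)` (`G_∞ = Δ × Γ′`); the Tate twist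
`T₂W ⊂ V(f)(1)` is handled over the full tower exactly as at odd `p` (`μ_{2^n} ⊂ ℚ(ζ_{2^n})`).
(β₂.2) Torsion free: `Λ_K = ℤ₂⟦T⟧ ⊕ ℤ₂⟦T⟧·c` is free of rank `2` over the domain `ℤ₂⟦T⟧`, so a
nonzero `f ∈ ℤ₂⟦T⟧` is a non-zero-divisor of `Λ_K` and acts injectively on `𝐇¹(T)` (Thm. 12.4 (2), in
the sense of its proof, p. 228: "Let `x` be a non-zero-divisor of `Λ`. We prove that `x : 𝐇¹(T) →
𝐇¹(T)` is injective"), hence on the submodule `𝐇¹_Γ`.  (β₂.3) Rank one: after `⊗ ℚ` the idempotents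
`e_± = (1 ± c)/2` exist and `𝐇¹(T) ⊗ ℚ` is free of rank `1` over `Λ_K ⊗ ℚ = ∏_{j ∈ ℤ/2}(Λ_K)_j ⊗ ℚ`
(Thm. 12.4 (2) with (12.1.3)); the restriction lands in the `Δ`-invariants `e₊(𝐇¹(T) ⊗ ℚ)` and contains
`res (cor 𝐇¹(T)) = (1 + c)·𝐇¹(T)`, which spans them, so `𝐇¹_Γ ⊗ ℚ ≅ e₊(𝐇¹(T) ⊗ ℚ)` is free of rank
`1` over `ℤ₂⟦T⟧ ⊗ ℚ`.  (β₂.4) Finitely generated: `𝐇¹(T)` is finitely generated over `Λ_K` ((12.2.1)) and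
`Λ_K` is finite over the noetherian `ℤ₂⟦T⟧`, so the submodule `𝐇¹_Γ` is finitely generated.

**The pin (design = the `SelmerDualData` pattern, file `IwasawaSelmer` part (d)).** Mathlib has no
inverse limits of continuous cohomology with their `Λ`-module structure; the tree has the finite
levels: `H1 (tateRep W p) U` (continuous cochain cohomology of the open subgroup `U ≤ Γ_ℚ`, file
`EulerSystem`), restriction `resLe`, corestriction `coresLe`, the `Γ_ℚ`-action `conjMap` (file
`ContinuousCorestriction`), inertia groups of the primes of `ℤ̄` (`CyclotomicLevels`).  So
`IwasawaH1Data W p κ γ` is a HYPOTHESIS STRUCTURE: an abstract `Λ`-module `H` together with additive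
maps `proj n : H → H¹(ℚ_n, T_pW)` that (i) land in the integral classes `integralH1` (§8.2/Lemma 8.5),
(ii) are compatible with the corestrictions `ℚ_{n+1} → ℚ_n` (the "trace maps" of §12.2), (iii) are
jointly injective and (iv) jointly surjective onto the norm-compatible integral families — (i)–(iv)
say `(proj n)_n : H ≅ lim←_n H¹(ℤ_n[1/p], T_pW)` as abelian groups — and (v) intertwine `T ∈ Λ` with
`conj_γ − 1` and (vi) the constants `c ∈ ℤ_p ⊂ Λ` with the `ℤ_p`-module structure of the levels.
Nothing is hidden: (v)–(vi) pin the `ℤ_p[T]`-structure, and since each `H¹(ℤ_n[1/p], T_pW)` is a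
finitely generated (hence `p`-adically separated) `ℤ_p`-module on which `(γ − 1)^{p^n}` acts
divisibly by `p`, they pin the `ℤ_p⟦T⟧`-structure (any two such structures agree) — the continuous
`Λ`-action of [Kato §12.2] written out without topology, as `IwasawaDualModule.lean` does for the
discrete side.  EXISTENCE of such a datum (the construction of the `Λ`-action on the limit) is the
named fact `nonempty_iwasawaH1Data` ((12.2.1) + p. 228), the analogue of
`WeierstrassCurve.nonempty_selmerDualData`; no statement of this file depends on it.

## What is NOT here (scope)

`𝐇²(T)` (no corestriction in degree `2` in the tree: it enters the companion file
`Kato2004/MainConjectureInputs.lean` inside ONE existential package, where the §17.13 sequence pins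
its lengths), `𝐇^q_loc`, the tame levels `ℚ_n(μ_r)` of a Λ-adic Euler / Kolyvagin system
(Mazur–Rubin 2004 §5.3 — TODO(general form): the same structure along `U_r ⊓ κ.layerSubgroup n`),
reduction modulo `p` (`𝒯 = 𝕋/p` of the cell's memo), Poitou–Tate over `Λ`; Thm. 12.4 (1), 12.5, 12.6
(companion file); any proof.  No `instance` beyond the structure-projection attributes, no notation.

## References

* K. Kato, *p-adic Hodge theory and values of zeta functions of modular forms*, Astérisque 295 (2004)
  117–290: §8.2 (pp. 180–181), Lemma 8.5 (pp. 183–184), §12.1 (12.1.2) (p. 219), §12.2 (12.2.1)–(12.2.2)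
  (p. 220), §12.3, Thm. 12.4 (p. 221), §13.1, Thm. 13.4 (pp. 224–226), §13.8 (pp. 227–229) — read
  2026-08-26 from the store text `paper:doi-10-24033-ast-639` (pp. 104–114). [Kato2004Asterisque]
* K. Rubin, *Euler Systems*, Ann. of Math. Stud. 147 (2000), App. B §2–3 (continuous cohomology,
  `H¹(K,T) = lim H¹(K,T/p^n)`, B.3.3 = Kato's [Ru4]). [Rubin2000]
* B. Perrin-Riou, Astérisque 229 (1995), §1.3 (= Kato's [Pe3]: (12.2.1)–(12.2.2)); cited through Kato.
* Tree: `Kato2004/EulerSystemValues.lean` (`tateRep`, `ZetaBody` (C2)), `IwasawaSelmer.lean`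
  (`SelmerDualData`, the pattern), `ZpExtension.lean` (`layerSubgroup`), `EulerSystem.lean` (`H1`,
  `coresLe` packaging `EulerSystemLevels.coresP`), `KatoDivisibilitySkeletonProofs.lean` (consumer shape:
  `[Module.IsTorsionFree Λ H]`, `Module.rank Λ H ≤ 1`).
-/

noncomputable section

open scoped NumberField
open Field IsDedekindDomain CategoryTheory
open Literature.NumberTheory.GaloisRepresentations
open Literature.NumberTheory.EllipticCurves Literature.NumberTheory.EllipticCurves.Kato2004
open Literature.NumberTheory.EllipticCurves.Kato2004.EulerSystemValues Rat.HeightOneSpectrum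

namespace Literature.NumberTheory.EllipticCurves.Kato2004

/-! ## §8.2 with Lemma 8.5: the integral classes `H¹(O_F[1/p], T) ↪ H¹(F, T)` -/

section Integral

variable {A : Type} [CommRing A] [TopologicalSpace A] {M : Type} [AddCommGroup M] [Module A M]
  [TopologicalSpace M] [IsTopologicalAddGroup M] [ContinuousSMul A M]

/-- **`H¹(O_F[1/p], T)` as a submodule of `H¹(F, T)`** for the fixed field `F = ℚ̄^U` of an open
subgroup `U ≤ Γ_ℚ` and a `p`-adic representation `T` of `Γ_ℚ`: the classes whose restriction to
`U ⊓ I_𝔓` vanishes for every prime `𝔓` of `ℤ̄` above a rational prime `v ≠ p` — "unramified away from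
`p`" at CLASS level, places where `T` ramifies included.  Kato §8.2 defines `H^q(R, T)` as étale
cohomology of `j_*T` and Lemma 8.5 (1) prints the injectivity of `H¹(O_K[S⁻¹], T) → H¹(K, T)` with
`H¹(O_v, T) = H¹(Gal(K_v^{ur}/K_v), H⁰(K_v^{ur}, T))` [p. 184]; the description of the image by
vanishing on inertia is the Leray reading recorded in the module docstring (= clause (C2) of
`Kato2004.ZetaBody`).  [cite: Kato2004Asterisque, §8.2 (pp. 180–181) and Lemma 8.5 (pp. 183–184)] -/
def integralH1 (T : GaloisRep ℚ A M) (p : ℕ) (U : Subgroup (absoluteGaloisGroup ℚ)) :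
    Submodule A (H1 T U) where
  carrier := {x | ∀ v : HeightOneSpectrum (𝓞 ℚ), ((primesEquiv v : Nat.Primes) : ℕ) ≠ p →
    ∀ 𝔓 ∈ v.primesAbove,
      resLe T.toTopRep (inf_le_left : U ⊓ 𝔓.inertia (absoluteGaloisGroup ℚ) ≤ U) 1 x = 0}
  zero_mem' := fun _ _ _ _ ↦ map_zero _
  add_mem' := by
    intro x y hx hy v hv 𝔓 h𝔓
    rw [map_add, hx v hv 𝔓 h𝔓, hy v hv 𝔓 h𝔓, add_zero]
  smul_mem' := by
    intro a x hx v hv 𝔓 h𝔓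
    rw [map_smul, hx v hv 𝔓 h𝔓, smul_zero]

/-- Membership in `integralH1`: the restriction of the class to `U ⊓ I_𝔓` vanishes for every prime
`𝔓` of `ℤ̄` over every rational prime `v ≠ p`. [cite: Kato2004Asterisque, §8.2 and Lemma 8.5 (pp. 180–184)] -/
theorem mem_integralH1_iff (T : GaloisRep ℚ A M) (p : ℕ) (U : Subgroup (absoluteGaloisGroup ℚ))
    (x : H1 T U) :
    x ∈ integralH1 T p U ↔ ∀ v : HeightOneSpectrum (𝓞 ℚ), ((primesEquiv v : Nat.Primes) : ℕ) ≠ p →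
      ∀ 𝔓 ∈ v.primesAbove,
        resLe T.toTopRep (inf_le_left : U ⊓ 𝔓.inertia (absoluteGaloisGroup ℚ) ≤ U) 1 x = 0 :=
  Iff.rfl

end Integral

/-! ## §12.2: the trace maps along the layers of a `ℤ_p`-extension -/

section Layers

variable {A : Type} [CommRing A] [TopologicalSpace A] {M : Type} [AddCommGroup M] [Module A M]
  [TopologicalSpace M] [IsTopologicalAddGroup M] [ContinuousSMul A M]
  (T : GaloisRep ℚ A M) {p : ℕ} [Fact p.Prime] (κ : ZpExtension ℚ p)

/-- The corestriction ("trace map" of Kato §12.2) `Cor : H¹(ℚ_{n+1}, T) → H¹(ℚ_n, T)` between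
consecutive layers `ℚ_n ⊂ ℚ_{n+1}` of the `ℤ_p`-extension `κ` (`κ.layerSubgroup (n+1) ≤ κ.layerSubgroup n`,
open of finite index in the compact group `Γ_ℚ`), packaged from the tree's relative corestriction
`coresLe` exactly as `EulerSystemLevels.coresP` is.  [cite: Kato2004Asterisque, §12.2 (p. 220)] -/
def layerCores (n : ℕ) : H1 T (κ.layerSubgroup (n + 1)) →ₗ[A] H1 T (κ.layerSubgroup n) :=
  haveI : (κ.layerSubgroup (n + 1)).FiniteIndex :=
    finiteIndex_of_isOpen_of_compactSpace _ (κ.isOpen_layerSubgroup (n + 1))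
  haveI : Fintype (κ.layerSubgroup n ⧸ (κ.layerSubgroup (n + 1)).subgroupOf (κ.layerSubgroup n)) :=
    Fintype.ofFinite _
  coresLe T.toTopRep (κ.layerSubgroup_antitone (Nat.le_succ n)) (κ.isOpen_layerSubgroup (n + 1))

/-- A family `y = (y_n)_n`, `y_n ∈ H¹(ℚ_n, T)`, is a **norm-compatible integral family** along `κ`:
every `y_n` lies in `H¹(ℤ_n[1/p], T)` and `Cor(y_{n+1}) = y_n` — an element of
`lim←_n H¹(ℤ_n[1/p], T)` written levelwise (Kato §12.2: "the inverse limit is taken with respect to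
trace maps"; Thm. 13.4: "`Z` … generated by `(z_{p^n})_n`").
[cite: Kato2004Asterisque, §12.2 (p. 220) and Thm. 13.4 (p. 226)] -/
def IsNormCompatible (y : ∀ n : ℕ, H1 T (κ.layerSubgroup n)) : Prop :=
  (∀ n, y n ∈ integralH1 T p (κ.layerSubgroup n)) ∧ ∀ n, layerCores T κ n (y (n + 1)) = y n

/-- The norm-compatible integral families form an `A`-submodule of `∏_n H¹(ℚ_n, T)` (the maps `Cor`
and the conditions of `integralH1` are `A`-linear): the inverse limit `lim←_n H¹(ℤ_n[1/p], T)` of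
Kato §12.2 written inside the product. [cite: Kato2004Asterisque, §12.2 (p. 220)] -/
def normCompatible : Submodule A (∀ n : ℕ, H1 T (κ.layerSubgroup n)) where
  carrier := {y | IsNormCompatible T κ y}
  zero_mem' := ⟨fun n ↦ (integralH1 T p _).zero_mem, fun n ↦ by simp only [Pi.zero_apply, map_zero]⟩
  add_mem' := fun {y y'} hy hy' ↦
    ⟨fun n ↦ (integralH1 T p _).add_mem (hy.1 n) (hy'.1 n),
      fun n ↦ by simp only [Pi.add_apply, map_add, hy.2 n, hy'.2 n]⟩
  smul_mem' := fun a y hy ↦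
    ⟨fun n ↦ (integralH1 T p _).smul_mem a (hy.1 n),
      fun n ↦ by simp only [Pi.smul_apply, map_smul, hy.2 n]⟩

/-- Membership in `normCompatible` (unfolding). [cite: Kato2004Asterisque, §12.2 (p. 220)] -/
@[simp] theorem mem_normCompatible_iff (y : ∀ n : ℕ, H1 T (κ.layerSubgroup n)) :
    y ∈ normCompatible T κ ↔ IsNormCompatible T κ y :=
  Iff.rfl

end Layers

/-! ## §12.2 for `T = T_pW` along the cyclotomic `ℤ_p`-tower: the pinned interface `𝐇¹_Γ(T_pW)` -/

section Interface

variable (W : WeierstrassCurve ℚ) [W.IsElliptic] (p : ℕ) [Fact p.Prime]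
  [ContinuousSMul ℤ_[p] (W.tateModule p)] (κ : ZpExtension ℚ p) (γ : absoluteGaloisGroup ℚ)

/-- **Kato's `𝐇¹(T) = lim←_n H¹(ℤ[ζ_{p^n}, 1/p], T)` for `T = T_pW`, along the layers of the
`ℤ_p`-extension `κ` (Δ-trivial component; module docstring "READING"), as a `Λ = ℤ_p⟦T⟧`-module with
`T = conj_γ − 1` — hypothesis structure, the exact analogue of `WeierstrassCurve.SelmerDualData`.**
Data: an abstract `Λ`-module `H` and additive maps `proj n : H → H¹(ℚ_n, T_pW)` (`ℚ_n` = the fixed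
field of `κ.layerSubgroup n`).  Axioms: `proj_mem` (values in `H¹(ℤ_n[1/p], T_pW) = integralH1`,
§8.2/Lemma 8.5), `cores_proj` (compatible with the trace maps, §12.2), `proj_injective` and
`proj_surjective` (so `(proj n)_n` is a bijection `H ≅ lim←_n H¹(ℤ_n[1/p], T_pW)` of abelian groups),
`proj_T_smul` (`T ∈ Λ` acts as `conj_γ − 1`, `γ` the intended topological generator of `Gal(ℚ_∞/ℚ)`)
and `proj_C_smul` (constants `c ∈ ℤ_p` act through the `ℤ_p`-module structure of the levels).
Nothing asserted; existence = `nonempty_iwasawaH1Data`; the structure facts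
`ContinuousSMul ℤ_[p] (W.tateModule p)` are instance BINDERS as in `EulerSystemValues.tateRep`.
[cite: Kato2004Asterisque, §12.2 (p. 220), §8.2 and Lemma 8.5 (pp. 180–184), §13.8 (p. 228)] -/
structure IwasawaH1Data where
  /-- The underlying type of the Iwasawa cohomology module `𝐇¹_Γ(T_pW)`. -/
  H : Type
  /-- `𝐇¹` is an abelian group. -/
  [addCommGroup : AddCommGroup H]
  /-- `𝐇¹` is a `Λ = ℤ_p⟦T⟧`-module. -/
  [module : Module (IwasawaAlgebra p) H]
  /-- The projection to the `n`-th layer `H¹(ℚ_n, T_pW)`. -/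
  proj : ∀ n : ℕ, H →+ H1 (tateRep W p) (κ.layerSubgroup n)
  /-- The projections are integral classes: `proj n x ∈ H¹(ℤ_n[1/p], T_pW)` (§8.2, Lemma 8.5). -/
  proj_mem : ∀ (n : ℕ) (x : H), proj n x ∈ integralH1 (tateRep W p) p (κ.layerSubgroup n)
  /-- Compatibility with the trace maps `Cor : H¹(ℚ_{n+1}, T) → H¹(ℚ_n, T)` (§12.2). -/
  cores_proj : ∀ (n : ℕ) (x : H), layerCores (tateRep W p) κ n (proj (n + 1) x) = proj n x
  /-- `(proj n)_n` is injective (an element of the inverse limit is determined by its components). -/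
  proj_injective : ∀ x : H, (∀ n, proj n x = 0) → x = 0
  /-- `(proj n)_n` is surjective onto the norm-compatible integral families (the inverse limit). -/
  proj_surjective : ∀ y : (∀ n : ℕ, H1 (tateRep W p) (κ.layerSubgroup n)),
    IsNormCompatible (tateRep W p) κ y → ∃ x : H, ∀ n, proj n x = y n
  /-- `T` acts as `conj_γ − 1` on every layer. -/
  proj_T_smul : ∀ (n : ℕ) (x : H),
    proj n ((PowerSeries.X : IwasawaAlgebra p) • x) =
      conjMap (tateRep W p).toTopRep (κ.layerSubgroup n) γ 1 (proj n x) - proj n x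
  /-- Constants `c ∈ ℤ_p` act through the `ℤ_p`-module structure of `H¹(ℚ_n, T_pW)`. -/
  proj_C_smul : ∀ (c : ℤ_[p]) (n : ℕ) (x : H), proj n (PowerSeries.C c • x) = c • proj n x

attribute [instance] IwasawaH1Data.addCommGroup IwasawaH1Data.module

namespace IwasawaH1Data

variable {W p κ γ} (I : IwasawaH1Data W p κ γ)

/-- The family of projections `x ↦ (proj n x)_n : 𝐇¹ → ∏_n H¹(ℚ_n, T_pW)`. [cite: Kato2004Asterisque, §12.2 (p. 220)] -/
def toFamily : I.H →+ (∀ n : ℕ, H1 (tateRep W p) (κ.layerSubgroup n)) where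
  toFun x n := I.proj n x
  map_zero' := funext fun n ↦ map_zero (I.proj n)
  map_add' x y := funext fun n ↦ map_add (I.proj n) x y

/-- Unfolding `toFamily`. [cite: Kato2004Asterisque, §12.2 (p. 220)] -/
@[simp] theorem toFamily_apply (x : I.H) (n : ℕ) : I.toFamily x n = I.proj n x := rfl

/-- `toFamily` is injective (`proj_injective`). [cite: Kato2004Asterisque, §12.2 (p. 220)] -/
theorem toFamily_injective : Function.Injective I.toFamily := by
  intro x y h
  rw [← sub_eq_zero]
  refine I.proj_injective _ fun n ↦ ?_
  have := congr_fun h n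
  simp only [toFamily_apply] at this
  rw [map_sub, this, sub_self]

/-- **Extensionality of `𝐇¹`:** two elements with the same image in every layer are equal.
[cite: Kato2004Asterisque, §12.2 (p. 220)] -/
theorem ext_of_proj {x y : I.H} (h : ∀ n, I.proj n x = I.proj n y) : x = y :=
  I.toFamily_injective (funext h)

/-- The image of `𝐇¹` in `∏_n H¹(ℚ_n, T_pW)` consists of norm-compatible integral families.
[cite: Kato2004Asterisque, §12.2 (p. 220)] -/
theorem isNormCompatible_toFamily (x : I.H) : IsNormCompatible (tateRep W p) κ (I.toFamily x) :=
  ⟨fun n ↦ I.proj_mem n x, fun n ↦ I.cores_proj n x⟩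

/-- The image of `𝐇¹` in `∏_n H¹(ℚ_n, T_pW)` IS the set of norm-compatible integral families.
[cite: Kato2004Asterisque, §12.2 (p. 220)] -/
theorem range_toFamily :
    Set.range I.toFamily = {y | IsNormCompatible (tateRep W p) κ y} := by
  ext y
  constructor
  · rintro ⟨x, rfl⟩
    exact I.isNormCompatible_toFamily x
  · intro hy
    obtain ⟨x, hx⟩ := I.proj_surjective y hy
    exact ⟨x, funext hx⟩

/-- **The Λ-adic class of a norm-compatible family (Kato, Thm. 13.4: "`Z` … generated by
`(z_{p^n})_n`"; §13.1).**  A norm-compatible family of integral classes `(y_n)_n` — e.g. the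
`p`-power levels of an Euler system for `T_pW` unramified away from `p` (`Kato2004.ZetaBody` (C1)(C2),
Ex. 13.3) pushed to the layers `ℚ_n` — defines a UNIQUE element `𝐳 ∈ 𝐇¹` with `proj n 𝐳 = y_n` for
all `n`.  Immediate from the pin; this is the CONSTRUCTION statement by which zeta elements enter `𝐇¹`.
[cite: Kato2004Asterisque, §13.1 and Thm. 13.4 (pp. 224–226)] -/
theorem exists_unique_lift {y : ∀ n : ℕ, H1 (tateRep W p) (κ.layerSubgroup n)}
    (hy : IsNormCompatible (tateRep W p) κ y) : ∃! x : I.H, ∀ n, I.proj n x = y n := by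
  obtain ⟨x, hx⟩ := I.proj_surjective y hy
  exact ⟨x, hx, fun x' hx' ↦ I.ext_of_proj fun n ↦ by rw [hx n, hx' n]⟩

/-- `proj n` is `ℤ_p`-linear for the structure `c ↦ C c` on `Λ` (restatement of `proj_C_smul` as a
`ℤ_p`-linear map, the shape in which the levels `H¹(ℚ_n, T_pW)` are `ℤ_p`-modules).
[cite: Kato2004Asterisque, §12.2 (p. 220)] -/
theorem proj_C_mul_smul (c : ℤ_[p]) (g : IwasawaAlgebra p) (n : ℕ) (x : I.H) :
    I.proj n ((PowerSeries.C c * g) • x) = c • I.proj n (g • x) := by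
  rw [mul_smul, I.proj_C_smul]

end IwasawaH1Data

end Interface

/-! ## The named facts: (12.2.1) + p. 228 (existence of the datum) and Thm. 12.4 (2)(3) -/

/-- **Kato 2004, §12.2 (12.2.1) with §13.8 (p. 228): the Iwasawa cohomology `𝐇¹_Γ(T_pW)` exists as a
`Λ`-module** — i.e. the inverse limit `lim←_n H¹(ℤ_n[1/p], T_pW)` along the cyclotomic `ℤ_p`-extension
carries a (continuous) `ℤ_p⟦T⟧`-module structure with `T = conj_γ − 1`: `IwasawaH1Data W p κ γ` is
inhabited, for every elliptic curve `W/ℚ`, prime `p`, cyclotomic `κ` and topological generator `γ`.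
Printed: "(12.2.1) … `𝐇¹(T)` and `𝐇²(T)` are finitely generated `ℤ_p[[G_∞]]`-modules" [p. 220] and
"`𝐇^q(T) = lim←_n H^q(ℤ[1/p], T ⊗_{O_λ} O_λ[G_n])`" [p. 228] (the `Λ`-structure through the second
factor); the `Δ`-trivial component is a `ℤ_p⟦T⟧`-module ((12.1.2)).  The analogue of
`WeierstrassCurve.nonempty_selmerDualData`; a CONSTRUCTION fact (continuity of the `Γ`-action and
`p`-adic completeness of the levels), no arithmetic content.  Named fact; nothing asserted.
[cite: Kato2004Asterisque, §12.2 (12.2.1) (p. 220) and §13.8 (p. 228)] -/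
def nonempty_iwasawaH1Data : Prop :=
  ∀ (W : WeierstrassCurve ℚ) [W.IsElliptic] (p : ℕ) [Fact p.Prime]
    [ContinuousSMul ℤ_[p] (W.tateModule p)] (κ : ZpExtension ℚ p) (γ : absoluteGaloisGroup ℚ),
    κ.IsCyclotomic → κ.IsTopGenerator γ → Nonempty (IwasawaH1Data W p κ γ)

/-- **Kato 2004, Thm. 12.4 (2)(3) with (12.2.1), for `T = T_pW` on the `Δ`-trivial component
`𝐇¹_Γ(T_pW)` (module docstring READING; a special case of print, clause by clause).**  For every
elliptic curve `W/ℚ` (its newform `f_E` is the `f` of §12.3; `T_pW` is a `Gal(ℚ̄/ℚ)`-stable lattice of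
`V_{ℚ_p}(f)(1)`, and Thm. 12.4 holds for every lattice and is twist-invariant along the cyclotomic
tower), every prime `p`, cyclotomic `κ` with topological generator `γ`, and every datum
`I : IwasawaH1Data W p κ γ`:
* (12.2.1) `I.H` is a finitely generated `Λ`-module;
* Thm. 12.4 (2): `I.H` is torsion free of `Λ`-rank `1` ("`𝐇¹(T)` is a torsion free `Λ`-module, and
  `𝐇¹(T) ⊗ ℚ` … is a free `Λ ⊗ ℚ`-module of rank `1`");
* Thm. 12.4 (3): if `p ≠ 2` and `W[p]` is irreducible ("`T/m_λT` is irreducible as a two dimensional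
  representation of `Gal(ℚ̄/ℚ)` over `O_λ/m_λ`"), `I.H` is free of rank `1` over `Λ`.
Not here: Thm. 12.4 (1) (`𝐇²(T)` torsion — companion file).  This supplies the binders
`[Module.IsTorsionFree Λ H]`, `Module.rank Λ H ≤ 1` of `Kato2004.thm17_4_skeleton` /
`kato_divisibility_body_of_skeleton` for `H = I.H`, and (F3) "`𝐇¹` free of rank one" of the cell's
MU-TRANSFER-PROOF.  Named fact; nothing asserted; no `_holds` expected soon (the proof is §13/§15).
-- TODO(general form): Kato's full `𝐇¹(T)` over `Λ = O_λ[[G_∞]]` (all `Δ`-components, `p = 2`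
-- included), arbitrary newforms `f` of weight `k ≥ 2` with coefficients, arbitrary lattices `T`.
[cite: Kato2004Asterisque, Thm. 12.4 (2)(3) (p. 221) and (12.2.1) (p. 220)] -/
def thm12_4 : Prop :=
  ∀ (W : WeierstrassCurve ℚ) [W.IsElliptic] (p : ℕ) [Fact p.Prime]
    [ContinuousSMul ℤ_[p] (W.tateModule p)] (κ : ZpExtension ℚ p) (γ : absoluteGaloisGroup ℚ),
    κ.IsCyclotomic → κ.IsTopGenerator γ → ∀ I : IwasawaH1Data W p κ γ,
      Module.Finite (IwasawaAlgebra p) I.H ∧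
      (Module.IsTorsionFree (IwasawaAlgebra p) I.H ∧ Module.rank (IwasawaAlgebra p) I.H = 1) ∧
      (p ≠ 2 → W.HasIrreducibleModPGaloisRep p →
        Module.Free (IwasawaAlgebra p) I.H ∧ Module.finrank (IwasawaAlgebra p) I.H = 1)

/-- The consumer shape of Thm. 12.4 (2): under `thm12_4`, `I.H` is torsion free of rank `≤ 1` — the
two binders of `Kato2004.thm17_4_skeleton` (file `KatoDivisibilitySkeletonProofs`).
[cite: Kato2004Asterisque, Thm. 12.4 (2) (p. 221)] -/
theorem thm12_4.isTorsionFree_and_rank_le_one (h : thm12_4) (W : WeierstrassCurve ℚ) [W.IsElliptic]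
    (p : ℕ) [Fact p.Prime] [ContinuousSMul ℤ_[p] (W.tateModule p)] {κ : ZpExtension ℚ p}
    {γ : absoluteGaloisGroup ℚ} (hκ : κ.IsCyclotomic) (hγ : κ.IsTopGenerator γ)
    (I : IwasawaH1Data W p κ γ) :
    Module.IsTorsionFree (IwasawaAlgebra p) I.H ∧ Module.rank (IwasawaAlgebra p) I.H ≤ 1 := by
  obtain ⟨-, ⟨htf, hrk⟩, -⟩ := h W p κ γ hκ hγ I
  exact ⟨htf, hrk.le⟩

end Literature.NumberTheory.EllipticCurves.Kato2004

end
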